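import Literature.MathematicalPhysics.QuantumFieldTheory.Balaban1983to89.B9Eq315QTorus

/-!
# `Balaban1983to89.B5Eq157AveragedConstants` — T. Bałaban, *Propagators and renormalization transformations for lattice gauge theories. I*,
# Commun. Math. Phys. **95** (1984) 17–40 [Balaban1984PropagatorsI] ("B5") p. 27, the sentence after (1.57) «we can identify Q_kA₀ = B₀»:
# AT THE FLAT BACKGROUND the one-step vector averaging `Q(1)` of [Balaban1985BackgroundPropagators] (3.15) ∕ [Balaban1985Averaging] (124)
# maps a direction-wise constant vector function `A₀` to THE SAME constant on the coarse torus, injectively — the displayed hypothesis (H3)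
# («`Q(1)` maps the constants into the coarse constants, injectively») of the cell's flat-positivity files, PROVED for the typed `Q(1)`

statement-level skeleton of published theorems with citation tags; proofs where landed; nothing here is a claim
about the Yang–Mills mass gap

CITATION HEADER (lean-in-tree rule).  Audit cell `pub-balaban`, sub-cell `t4`, row NE9; filed by the NE9 crux-team leaf seat
`b2b-balaban-t4-ne9-formalise-leaf-02` (gen 51) as the TAKE of the row owner's OFFER O-ne9p1-g79-1 (`b2b-balaban-t4-ne9-p1` gen 79, journal
l.36146, item (H3); journal l.36216).  Sources READ by this seat: [Balaban1984PropagatorsI] pp. 22, 27, 30 in the held text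
`paper:balaban1984-cmp95-propagators-rt-i` (journal page = PDF page + 16; p. 30 also on the page image); [Balaban1985BackgroundPropagators] p. 393
(`paper:balaban1985-cmp99-background-propagators`, journal page = PDF page + 388); T. Bałaban, *Averaging operations for lattice gauge theories*,
Commun. Math. Phys. **98** (1985) 17–51 [Balaban1985Averaging] p. 36 (`paper:balaban1985-cmp98-averaging`, journal page = PDF page + 16).

THE PRINT.  [Balaban1984PropagatorsI] p. 27: *«It implies that B − Q_kA₀ is orthogonal to constant functions. Taking the decomposition B = B′ + B₀,
where B₀ is a constant configuration and B′ is in the orthogonal subspace, we can identify Q_kA₀ = B₀, or A₀ = Q*_kB₀.»*; p. 30: *«A = ∂(…)ω + A₀,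
where A₀ is a constant vector function»*, *«QA = … = ∂₁ω + A₀ = 0»* (so `Q` of the constant vector function `A₀` is written as the constant `A₀`
on the unit lattice); p. 22: *«the operator Q′_k transforms constant functions on the η-lattice into constant functions on the unit lattice»*.
[Balaban1985BackgroundPropagators] (3.15) p. 393: *«Q_j(U) = Q(Ū^{j−1})…Q(Ū)Q(U), where Q(V) is given by the explicit formula (124) in [5].»*
[Balaban1985Averaging] (124) p. 36: the linear form `Q(V₀)A`, whose main term at `V₀ = 1` is the plain average over the `L^d` block sites of the
sum along the `L` segment bonds, `Σ_{x∈B(c₋)} L^{−d} · L^{−1} Σ_{b⊂Γ} A(b)` in the tree's normalisation (READING C-adv4-22 of `B9Eq315QTorus`).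
A «constant vector function» has ONE value per lattice direction (`A₀(⟨x, x+e_κ⟩) = v_κ`); every bond entering `(Q(1)A)(⟨y, y+e_κ⟩)` points in
the direction `κ`, so the average of `A₀` there is `v_κ` again.

WHAT IS PROVED (sorry-free; proof lane — no `def`, no `Prop` placeholder, no inequality of the papers).
* §1 **`QtorusLin_one_constDir`**: for `v : Fin d → 𝔸`, `Q(1)(b ↦ v_{κ(b)})(c) = v_{κ(c)}` on the torus `T_{L·P} → T_P` (via
  `B7Prop3GeneralLinear.linQcov_one_left` → `B7Prop3Flat.linQ` → `B7Prop1Explicit.asum_seg_natCast`: `L^d·L` equal summands against the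
  `L^{−d}`, `L⁻¹` normalisations; the direction-blind special case is `B9Eq315QTowerFlat.QtorusLin_one_const`).
* §2 **`QtorusW_one_constDir`**: the same for `B9Eq315QTorus.QtorusW` on the weighted `L²` spaces of `W`-valued bond functions (fibre read along
  `φ : W ≃ₗ[ℂ] 𝔸`): `Q(1)` maps `(WL2.linearEquiv …)⁻¹ (b ↦ w_{κ(b)})` (fine, weight `c₀`) to `(WL2.linearEquiv …)⁻¹ (b ↦ w_{κ(b)})` (coarse, weight `c₁`).
* §3 **`constDir_eq_zero_iff`** ∕ `constDirL2_eq_zero_iff`: a direction-wise constant vanishes iff its value vector does (every direction carries a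
  bond of the torus) — the injectivity half of «Q_kA₀ = B₀ … A₀ = Q*_kB₀».
* §4 **`QtorusW_one_mapsTo_constRange`** ∕ **`QtorusW_one_constRange_eq_zero`**: the two statements in the binder shape of the cell's flat
  coercivity END (`hQHarm` ∕ `hQinj` over `LinearMap.range ((WL2.linearEquiv …).symm ∘ₗ LinearMap.funLeft ℂ W Prod.snd)` — the range of the
  «constant vector functions» map): `Q(1)` maps that range (fine) INTO that range (coarse), and kills no non-zero element of it.
MODEL ∕ DECLARED READINGS.  (M1) «constant vector function» = a bond function depending only on the bond's direction, `b ↦ v b.2` on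
`Bond d P = TSite d P × Fin d` (print's `A₀`, one value per component `A_μ`, p. 30 «For each component A_μ»).  (M2) `Q(1)` = `B9Eq315QTorus.QtorusLin`
∕ `QtorusW` at the background `fun _ ↦ 1` with its displayed (here trivially true) unit-boundedness ∕ block-regularity data carried as binders, as
in the consumer files.  (M3) NOT HERE: (1.55) `Q(1)∂ = ∂₁Q′(1)` (the sibling (H2) file), the Poincaré lemma, anything at `U ≠ 1`, any estimate.
HONEST SCOPE.  A [folklore]-level identity (an average of a constant is the constant) for the cell's typed one-step averaging; NOT summit progress
(cell pub-balaban: NE9 NOT PRINTED ∕ NOT PROVED; spine PROVED 0∕9).  NEW file importing `B9Eq315QTorus` only; nothing modified.  Net new unproved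
facts: 0.
-/

noncomputable section

open scoped BigOperators

namespace Literature.MathematicalPhysics.QuantumFieldTheory.Balaban1983to89.B5Eq157AveragedConstants

open B4Sect5Torus (TSite)
open B9SectCLatticeCarrier (Bond)
open B7Prop1Explicit (U1 Wcx boxVec asum_seg_natCast)
open B7Prop3Flat (linQ)
open B7Prop3GeneralLinear (linQcov_one_left)
open B9Eq311L2Pairing (WL2)
open B11Eq103H1Complex (BondL2K)
open B9Eq319QprimeTorus (fineP)
open B9Eq315QTorus (perCfg cornerSite QtorusLin QtorusLin_apply QtorusW QtorusW_apply)

variable {d : ℕ} {𝔸 : Type*} [NormedRing 𝔸] [NormedAlgebra ℂ 𝔸] [CompleteSpace 𝔸] [NormOneClass 𝔸]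
  (L : ℕ) (P : Fin d → ℕ) [∀ i, NeZero (fineP L P i)] (hL : 1 ≤ L) {α : ℝ} (hα1 : α ≤ 1 / 64)
  (hU1 : ∀ (x : B7Prop1Explicit.Site d) (κ : Fin d), perCfg (fineP L P) (fun _ : Bond d (fineP L P) => (1 : 𝔸ˣ)) x κ ∈ U1 𝔸)
  (hreg : ∀ (y : TSite d P) (κ : Fin d) (r : Fin d → Fin L),
    ‖((Wcx L (perCfg (fineP L P) (fun _ : Bond d (fineP L P) => (1 : 𝔸ˣ))) (cornerSite L y) κ (boxVec L r) : 𝔸ˣ) : 𝔸) - 1‖ ≤ α)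

/-! ## §1 «Q_kA₀ = B₀»: `Q(1)` of a direction-wise constant, on `𝔸`-valued bond functions -/

include hL in
/-- **«we can identify Q_kA₀ = B₀» — the one-step vector averaging AT THE FLAT BACKGROUND reproduces direction-wise constants**: for
`A₀(b) = v_{κ(b)}`, `(Q(1)A₀)(c) = v_{κ(c)}` on the torus `T_{L·P} → T_P`; at `V₀ = 1` the linear form (124) is its main term, the plain average
over the `L^d` block sites and the `L` bonds of the straight contour in the direction `κ(c)`, all of which carry the value `v_{κ(c)}`.
[cite: Balaban1984PropagatorsI, p.27, p.30; Balaban1985Averaging, (124) p.36; Balaban1985BackgroundPropagators, (3.15) p.393] -/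
theorem QtorusLin_one_constDir (v : Fin d → 𝔸) (c : Bond d P) :
    QtorusLin L P hL (fun _ => 1) hα1 hU1 hreg (fun b => v b.2) c = v c.2 := by
  have hL0 : L ≠ 0 := by omega
  have hLr : (L : ℝ) ≠ 0 := by exact_mod_cast hL0
  have hLc : (L : ℂ) ≠ 0 := by exact_mod_cast hL0
  have hM0 : 0 ≤ ∑ κ, ‖v κ‖ := Finset.sum_nonneg fun κ _ => norm_nonneg _
  have hM : ∀ (x : B7Prop1Explicit.Site d) (κ : Fin d), ‖(fun (_ : B7Prop1Explicit.Site d) (κ' : Fin d) => v κ') x κ‖ ≤ ∑ κ, ‖v κ‖ :=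
    fun x κ => Finset.single_le_sum (fun κ' _ => norm_nonneg (v κ')) (Finset.mem_univ κ)
  rw [QtorusLin_apply, show perCfg (fineP L P) (fun _ : Bond d (fineP L P) => (1 : 𝔸ˣ)) = 1 from rfl,
    show perCfg (fineP L P) (fun b : Bond d (fineP L P) => v b.2) = fun _ κ' => v κ' from rfl, linQcov_one_left L hL _ hM0 hM]
  simp only [linQ, asum_seg_natCast, Finset.sum_const, Finset.card_range, Finset.card_univ, Fintype.card_pi, Finset.prod_const,
    Fintype.card_fin]
  rw [← Nat.cast_smul_eq_nsmul ℝ (L ^ d), smul_smul, Nat.cast_pow, mul_inv_cancel₀ (pow_ne_zero _ hLr), one_smul,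
    ← Nat.cast_smul_eq_nsmul ℂ L, smul_smul, inv_mul_cancel₀ hLc, one_smul]

/-- … as an identity of bond functions: `Q(1)(b ↦ v_{κ(b)}) = (c ↦ v_{κ(c)})`. [cite: Balaban1984PropagatorsI, p.27; Balaban1985BackgroundPropagators, (3.15) p.393] -/
theorem QtorusLin_one_constDir_eq (v : Fin d → 𝔸) :
    QtorusLin L P hL (fun _ => 1) hα1 hU1 hreg (fun b => v b.2) = fun c => v c.2 :=
  funext fun c => QtorusLin_one_constDir L P hL hα1 hU1 hreg v c

/-! ## §2 The same on the weighted `L²` spaces of `W`-valued bond functions -/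

section L2

variable {W : Type*} [NormedAddCommGroup W] [InnerProductSpace ℂ W] (φ : W ≃ₗ[ℂ] 𝔸) {c₀ c₁ : ℝ}

include hL in
/-- **«Q_kA₀ = B₀» on the `L²` letters of the cell**: `QtorusW … 1 …` maps the fine constant vector function with value vector `w : Fin d → W`
(weight `c₀`) to the coarse constant vector function with the SAME value vector (weight `c₁`) — the fibre is read along `φ` and back.
[cite: Balaban1984PropagatorsI, p.27, p.30; Balaban1985BackgroundPropagators, (3.15)–(3.16) p.393] -/
theorem QtorusW_one_constDir (w : Fin d → W) :
    QtorusW L P hL φ (fun _ => 1) hα1 hU1 hreg (c₀ := c₀) (c₁ := c₁)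
        ((WL2.linearEquiv ℂ ℂ (fun _ : Bond d (fineP L P) => c₀)).symm fun b => w b.2) =
      (WL2.linearEquiv ℂ ℂ (fun _ : Bond d P => c₁)).symm fun b => w b.2 := by
  apply (WL2.equiv ℂ (fun _ : Bond d P => c₁) W).injective
  funext c
  rw [QtorusW_apply]
  show φ.symm (QtorusLin L P hL (fun _ => 1) hα1 hU1 hreg (fun b => φ (w b.2)) c) = w c.2
  rw [QtorusLin_one_constDir L P hL hα1 hU1 hreg (fun κ => φ (w κ)) c, LinearEquiv.symm_apply_apply]

end L2

/-! ## §3 Injectivity: a direction-wise constant vanishes iff its value vector does -/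

section Injective

variable {V : Type*} [Zero V] (Pd : Fin d → ℕ) [∀ i, NeZero (Pd i)]

omit [∀ i, NeZero (fineP L P i)] in
/-- Every direction carries a bond of the torus `T_P` (all periods positive), so `(b ↦ v_{κ(b)}) = 0 ↔ v = 0` — the injectivity behind «Q_kA₀ = B₀,
or A₀ = Q*_kB₀». [cite: Balaban1984PropagatorsI, p.27] -/
theorem constDir_eq_zero_iff (v : Fin d → V) : (fun b : Bond d Pd => v b.2) = 0 ↔ v = 0 := by
  constructor
  · intro h
    funext κ
    exact congrFun h ((fun i => (0 : Fin (Pd i))), κ)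
  · rintro rfl
    rfl

variable {W : Type*} [AddCommGroup W] [Module ℂ W] {c : ℝ}

omit [∀ i, NeZero (fineP L P i)] in
/-- … and the same read into the weighted `L²` space. [cite: Balaban1984PropagatorsI, p.27] -/
theorem constDirL2_eq_zero_iff (w : Fin d → W) :
    (WL2.linearEquiv ℂ ℂ (fun _ : Bond d Pd => c)).symm (fun b => w b.2) = 0 ↔ w = 0 := by
  rw [LinearEquiv.map_eq_zero_iff, constDir_eq_zero_iff]

end Injective

/-! ## §4 The binder shapes of the cell's flat-coercivity END: `Q(1)` on the range of the «constant vector functions» map -/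

section Range

variable [∀ i, NeZero (P i)] {W : Type*} [NormedAddCommGroup W] [InnerProductSpace ℂ W] (φ : W ≃ₗ[ℂ] 𝔸) {c₀ c₁ : ℝ}

include hL in
omit [∀ i, NeZero (P i)] in
/-- **(H3), first half — `Q(1)` maps the constant vector functions INTO the coarse constant vector functions**: for `h` in the range of
`v ↦ (WL2.linearEquiv …)⁻¹ (b ↦ v_{κ(b)})` (fine torus, weight `c₀`), `Q(1)h` lies in the range of the same map on the coarse torus (weight `c₁`) —
with the same value vector. [cite: Balaban1984PropagatorsI, p.27, p.30; Balaban1985BackgroundPropagators, (3.15) p.393] -/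
theorem QtorusW_one_mapsTo_constRange :
    ∀ h ∈ LinearMap.range ((WL2.linearEquiv ℂ ℂ (fun _ : Bond d (fineP L P) => c₀)).symm.toLinearMap ∘ₗ
        LinearMap.funLeft ℂ W (Prod.snd : Bond d (fineP L P) → Fin d)),
      QtorusW L P hL φ (fun _ => 1) hα1 hU1 hreg (c₀ := c₀) (c₁ := c₁) h ∈
        LinearMap.range ((WL2.linearEquiv ℂ ℂ (fun _ : Bond d P => c₁)).symm.toLinearMap ∘ₗ
          LinearMap.funLeft ℂ W (Prod.snd : Bond d P → Fin d)) := by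
  rintro _ ⟨w, rfl⟩
  exact ⟨w, (QtorusW_one_constDir L P hL hα1 hU1 hreg φ w).symm⟩

include hL in
/-- **(H3), second half — `Q(1)` kills no non-zero constant vector function** («A₀ = Q*_kB₀»: the value vector is recovered on the coarse torus,
every direction carrying a coarse bond). [cite: Balaban1984PropagatorsI, p.27, p.30; Balaban1985BackgroundPropagators, (3.15) p.393] -/
theorem QtorusW_one_constRange_eq_zero :
    ∀ h ∈ LinearMap.range ((WL2.linearEquiv ℂ ℂ (fun _ : Bond d (fineP L P) => c₀)).symm.toLinearMap ∘ₗ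
        LinearMap.funLeft ℂ W (Prod.snd : Bond d (fineP L P) → Fin d)),
      QtorusW L P hL φ (fun _ => 1) hα1 hU1 hreg (c₀ := c₀) (c₁ := c₁) h = 0 → h = 0 := by
  rintro _ ⟨w, rfl⟩ h0
  have h1 : (WL2.linearEquiv ℂ ℂ (fun _ : Bond d P => c₁)).symm (fun b => w b.2) = 0 :=
    (QtorusW_one_constDir L P hL hα1 hU1 hreg φ w).symm.trans h0
  rw [constDirL2_eq_zero_iff] at h1
  subst h1
  exact map_zero _

end Range

end Literature.MathematicalPhysics.QuantumFieldTheory.Balaban1983to89.B5Eq157AveragedConstants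

end
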